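import Literature.Algebra.EuclideanLattices.DualGridCosetModel
import Literature.Algebra.EuclideanLattices.MRCombiningProcedure
import HarnessLib

/-!
# One attempt of the `SIS`-based short-vector step on `Λ = det(B)²·L(B)*`: the exact integer arithmetic and MR07 Lemma 5.8 (ii), (iii)

Topic `Algebra/EuclideanLattices` (family `pqc`), sequel of `DualGridCosetModel.lean` (the lattice
`Λ = G ℤⁿ`, `B G = Dg I = G B`, the fine grid `(1/N)ℤⁿ`, the offset group `Grp` with `φ`, `rep`,
`reduceVec`). Written for the bit-level rendering of the first step of Micciancio–Regev 2007, Thm. 5.23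
(Cor. 5.13 = Thm. 5.9 iterated, run on the DUAL lattice; the verifier-free route
`Literature.Computability.Cryptography.owfExist_of_gapSVP_worstCaseHard_of_shortDual`). One ATTEMPT of
the reduction of Thm. 5.9 (authors' version p. 22, steps 2–4, with the combining procedure `A_F` of
Lemma 5.8, p. 21) is spelled out here in the EXACT INTEGER ARITHMETIC a machine performs, and the two
deterministic properties of Lemma 5.8 are derived for it from the tree's coordinate-free versions
(`MRCombiningProcedure.lean`):

Data: `B` (nonsingular), the grid parameter `N`, the current independent lattice vectors
`S = (s₀, …, s_{n-1}) ⊂ Λ` (integer rows), the modulus `q`; per sample `i < m` a grid noise numerator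
`Kᵢ ∈ ℤⁿ` (`rᵢ = Kᵢ/N`) and a `v`-randomness `κᵢ ∈ ℤⁿ` (`vᵢ = G κᵢ ∈ Λ`); the oracle's answer `z ∈ ℤᵐ`.

* `tauVec`, `TS` — the `G`-coordinates `τⱼ = B sⱼ/Dg ∈ ℤⁿ` of the `sⱼ` (`G τⱼ = sⱼ`, `G_mulVec_tauVec`) and
  their matrix (columns `τⱼ`; nonsingular, `det_TS_ne_zero`), with its exact inverse data
  `dT = det(TS)²`, `GT` (`TS GT = dT I`, `IntegerMatrixInverseGS`); `modM = dT·N·Dg`;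
* `Fvec`, `yVec` — `Fᵢ = ⌊-B Kᵢ/(N Dg)⌋`, the LATTICE vector `yᵢ = -G Fᵢ` of Lemma 5.7 (it is the second
  component of `gridSample`, `DualGridCosetModel.coe_gridSample_snd_eq`), and `crep = reduceVec (-K)`
  (`N ·` the parallelepiped-reduced offset representative `rep cᵢ`);
* `Vnum`, `flo`, `aEnt` — the numerators `Vᵢ = GT (B crepᵢ + N Dg κᵢ)` of the `S`-coordinates
  `σᵢ = S⁻¹(rep cᵢ + vᵢ) = Vᵢ/modM` (`sum_sigma_smul_eq`: `∑ⱼ σᵢⱼ sⱼ = rep cᵢ + vᵢ`), their floors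
  `⌊σᵢⱼ⌋` and the QUERY entries `aᵢⱼ = ⌊q σᵢⱼ⌋ mod q ∈ [0, q)` (`= ⌊q {σᵢⱼ}⌋`, `aEnt_eq_floor_fract`);
* `cw` — `cᵢ - wᵢ = -G κᵢ + ∑ⱼ ⌊σᵢⱼ⌋ sⱼ ∈ Λ` where `wᵢ = ∑ⱼ {σᵢⱼ} sⱼ ∈ P(S)` is the reduced point
  (`coe_crep_sub_wReal`);
* `Az`, `xVec`, `uVec` — `(A z)ⱼ = ∑ᵢ zᵢ aᵢⱼ`, `x = ∑ᵢ zᵢ (cᵢ - wᵢ) + ∑ⱼ ((A z)ⱼ / q) sⱼ` (integer division;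
  exact when `A z ≡ 0 (mod q)`), and the CANDIDATE `u = x - ∑ᵢ zᵢ yᵢ`;
* **membership**: `yVec_mem`, `cw_mem`, `xVec_mem`, `uVec_mem` — all in `Λ` (unconditionally: `x` is an
  integer combination of lattice vectors by construction);
* **MR07 Lemma 5.8 (ii)–(iii) for the attempt** (`coe_xVec_eq_combine`, `norm_xVec_sub_le`): when
  `A z ≡ 0 (mod q)`, `x` is the output of the combining procedure `A_F(B, S, C, q)` run with
  `cᵢ = rep cᵢ = crepᵢ/N` and `wᵢ`, hence `‖x - ∑ᵢ zᵢ cᵢ‖ ≤ n √m ‖z‖ ‖S‖/q`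
  (`MicciancioRegev2007.norm_combine_sub_le_sqrt`), and `u - t` decomposes as in the proof of Thm. 5.9
  (`coe_uVec_sub_eq`).

Everything is proved; the definitions have bodies; no named fact.

## References

* D. Micciancio, O. Regev, *Worst-case to average-case reductions based on Gaussian measures*,
  SIAM J. Comput. 37 (2007) 267–302; authors' version, Lemma 5.8 and its proof (p. 21: steps 1–5 of
  `A_F`), Thm. 5.9 (p. 22, steps 2–4; p. 23, `s = x - Yz`).
-/

noncomputable section

open scoped Classical

namespace Literature.Algebra.EuclideanLattices

open Module Submodule Matrix GSInverse Finset

namespace DualGrid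

variable {n m : ℕ} (B : Matrix (Fin n) (Fin n) ℤ) (N : ℕ) (S : Fin n → Fin n → ℤ)

/-! ### The `G`-coordinates of `S` and their inverse -/

/-- The `G`-coordinates `τⱼ = B sⱼ / Dg` of `sⱼ ∈ Λ` (exact division). [folklore] -/
def tauVec (j : Fin n) : Fin n → ℤ := fun l => (B *ᵥ S j) l / Dg B

/-- The matrix `TS` with COLUMNS `τⱼ` (so that the matrix of columns `sⱼ` is `G · TS`). [folklore] -/
def TS : Matrix (Fin n) (Fin n) ℤ := Matrix.of fun l j => tauVec B S j l

/-- `dT = det(TS)²`, the denominator of the exact inverse of `TS`. [cite: Cohen1993, §2.6.3] -/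
def dT : ℤ := invDen (rowsOf (TS B S))

/-- `GT`, with `TS · GT = dT · I`. [cite: Cohen1993, §2.6.3] -/
def GT : Matrix (Fin n) (Fin n) ℤ := invMatrix (TS B S)

/-- The modulus `modM = dT · N · Dg`: `S⁻¹` of a grid point has coordinates in `(1/modM)ℤ`. [folklore] -/
def modM : ℤ := dT B S * ((N : ℤ) * Dg B)

variable {B N S}

/-- **`G τⱼ = sⱼ`** for `sⱼ ∈ Λ`. [folklore] -/
theorem G_mulVec_tauVec (hB : B.det ≠ 0) {j : Fin n} (hS : intVecToEuclidean n (S j) ∈ dualLat B) :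
    G B *ᵥ tauVec B S j = S j := by
  obtain ⟨c, hc⟩ := (mem_dualLat_iff B _).1 hS
  have hc' : G B *ᵥ c = S j := intVecToEuclidean_injective n hc
  have hτ : tauVec B S j = c := by
    funext l
    simp only [tauVec]
    rw [← hc', B_mulVec_G_mulVec hB, Pi.smul_apply, smul_eq_mul, Int.mul_ediv_cancel_left _ (Dg_pos hB).ne']
  rw [hτ, hc']

/-- The columns of `G · TS` are the `sⱼ`: `(G · TS) l j = sⱼ l`. [folklore] -/
theorem G_mul_TS_apply (hB : B.det ≠ 0) (hS : ∀ j, intVecToEuclidean n (S j) ∈ dualLat B) (l j : Fin n) :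
    (G B * TS B S) l j = S j l := by
  have h := congrFun (G_mulVec_tauVec (S := S) hB (hS j)) l
  rw [Matrix.mul_apply]
  simp only [Matrix.mulVec, dotProduct, TS, Matrix.of_apply] at h ⊢
  exact h

/-- `det G ≠ 0`. [folklore] -/
theorem det_G_ne_zero (hB : B.det ≠ 0) : (G B).det ≠ 0 := by
  have h := congrArg Matrix.det (B_mul_G hB)
  rw [Matrix.det_mul, Matrix.det_smul, Matrix.det_one, mul_one] at h
  intro h0
  rw [h0, mul_zero] at h
  exact pow_ne_zero _ (Dg_pos hB).ne' h.symm

/-- **`TS` is nonsingular** when the `sⱼ` are linearly independent. [folklore] -/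
theorem det_TS_ne_zero (hB : B.det ≠ 0) (hS : ∀ j, intVecToEuclidean n (S j) ∈ dualLat B)
    (hli : LinearIndependent ℝ fun j => intVecToEuclidean n (S j)) : (TS B S).det ≠ 0 := by
  -- the matrix of columns `sⱼ` is `G · TS` and has nonzero determinant
  set Smat : Matrix (Fin n) (Fin n) ℤ := Matrix.of fun l j => S j l with hSmat
  have hGT : G B * TS B S = Smat := Matrix.ext fun l j => by rw [G_mul_TS_apply hB hS, hSmat, Matrix.of_apply]
  have hSdet : Smat.det ≠ 0 := by
    -- rows of `Smatᵀ` are the `sⱼ`, independent over `ℝ`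
    have hT : Smat.transpose = Matrix.of fun j l => S j l := by ext j l; simp [hSmat]
    rw [← Matrix.det_transpose, hT]
    have hreal : LinearIndependent ℝ ((Matrix.of fun j l => S j l).map (Int.cast : ℤ → ℝ)).row := by
      have e : ((Matrix.of fun j l => S j l).map (Int.cast : ℤ → ℝ)).row =
          ⇑(WithLp.linearEquiv 2 ℝ (Fin n → ℝ)) ∘ fun j => intVecToEuclidean n (S j) := by
        funext j; funext l; simp [Matrix.row]
      rw [e]
      exact hli.map' _ (LinearEquiv.ker _)
    have hu := Matrix.linearIndependent_rows_iff_isUnit.1 hreal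
    rw [Matrix.isUnit_iff_isUnit_det, isUnit_iff_ne_zero] at hu
    intro h0
    apply hu
    rw [show (Matrix.of fun j l => S j l).map (Int.cast : ℤ → ℝ) = (Int.castRingHom ℝ).mapMatrix (Matrix.of fun j l => S j l)
      from rfl, ← RingHom.map_det, h0, map_zero]
  intro h0
  apply hSdet
  rw [← hGT, Matrix.det_mul, h0, mul_zero]

/-- `TS · GT = dT · I`. [cite: Cohen1993, §2.6.3] -/
theorem TS_mul_GT (hB : B.det ≠ 0) (hS : ∀ j, intVecToEuclidean n (S j) ∈ dualLat B)
    (hli : LinearIndependent ℝ fun j => intVecToEuclidean n (S j)) :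
    TS B S * GT B S = dT B S • (1 : Matrix (Fin n) (Fin n) ℤ) :=
  mul_invMatrix_eq_invDen (det_TS_ne_zero hB hS hli)

/-- `dT = det(TS)² > 0`. [folklore] -/
theorem dT_pos (hB : B.det ≠ 0) (hS : ∀ j, intVecToEuclidean n (S j) ∈ dualLat B)
    (hli : LinearIndependent ℝ fun j => intVecToEuclidean n (S j)) : 0 < dT B S := by
  rw [dT, invDen_eq_det_sq (det_TS_ne_zero hB hS hli)]
  exact pow_pos (lt_of_le_of_ne (sq_nonneg _) (Ne.symm (pow_ne_zero 2 (det_TS_ne_zero hB hS hli)))) 1 |>.trans_le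
    (by rw [pow_one])

/-- `modM > 0`. [folklore] -/
theorem modM_pos (hB : B.det ≠ 0) [NeZero N] (hS : ∀ j, intVecToEuclidean n (S j) ∈ dualLat B)
    (hli : LinearIndependent ℝ fun j => intVecToEuclidean n (S j)) : 0 < modM B N S :=
  mul_pos (dT_pos hB hS hli) (mul_pos (by exact_mod_cast Nat.pos_of_ne_zero (NeZero.ne N)) (Dg_pos hB))

/-! ### One sample: the lattice vector `yᵢ`, the offset representative, the `S`-coordinates, the query -/

variable (B N S)

/-- `Fᵢ = ⌊-B Kᵢ/(N·Dg)⌋` (coordinatewise integer floor division). [cite: MicciancioRegev2007, Lemma 5.7 (y = r + c)] -/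
def Fvec (K : Fin n → ℤ) : Fin n → ℤ := fun l => (B *ᵥ (-K)) l / ((N : ℤ) * Dg B)

/-- **The lattice vector `yᵢ = -G Fᵢ ∈ Λ`** of the sampling procedure (`= rᵢ + rep cᵢ`). [cite: MicciancioRegev2007, Lemma 5.7 (y = r + c)] -/
def yVec (K : Fin n → ℤ) : Fin n → ℤ := -(G B *ᵥ Fvec B N K)

/-- `N ·` the reduced representative `rep cᵢ` of the offset class of `-rᵢ`. [cite: MicciancioRegev2007, Lemma 5.7 (c = -r mod P(B))] -/
def crep (K : Fin n → ℤ) : Fin n → ℤ := reduceVec B N (-K)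

/-- **The numerators `V = GT (B C + N Dg κ)`** of the `S`-coordinates `σ = V/modM` of `C/N + G κ`, for an
integer offset representative `C` (`N · rep c`) and a `v`-randomness `κ` (`v = G κ`).
[cite: MicciancioRegev2007, Lemma 5.8 (step 3: S⁻¹wᵢ)] -/
def VnumOf (C κ : Fin n → ℤ) : Fin n → ℤ := GT B S *ᵥ (B *ᵥ C + ((N : ℤ) * Dg B) • κ)

/-- The numerators `Vᵢ = GT (B crepᵢ + N Dg κᵢ)` for the sample with grid noise `Kᵢ`. [folklore] -/
abbrev Vnum (K κ : Fin n → ℤ) : Fin n → ℤ := VnumOf B N S (crep B N K) κ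

/-- `⌊σᵢⱼ⌋`. [folklore] -/
def flo (K κ : Fin n → ℤ) (j : Fin n) : ℤ := Vnum B N S K κ j / modM B N S

/-- **The query entry `aᵢⱼ = ⌊q σᵢⱼ⌋ mod q ∈ [0, q)`.** [cite: MicciancioRegev2007, Lemma 5.8 (step 3: aᵢ = ⌊q S⁻¹ wᵢ⌋)] -/
def aEnt (q : ℕ) (K κ : Fin n → ℤ) (j : Fin n) : ℤ := ((q : ℤ) * Vnum B N S K κ j / modM B N S) % q

/-- **`cᵢ - wᵢ = -G κᵢ + ∑ⱼ ⌊σᵢⱼ⌋ sⱼ`** (`wᵢ = (rep cᵢ + vᵢ) mod P(S)`). [cite: MicciancioRegev2007, Lemma 5.8 (proof of (ii): cᵢ - wᵢ = ((cᵢ+vᵢ) - wᵢ) - vᵢ)] -/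
def cw (K κ : Fin n → ℤ) : Fin n → ℤ := -(G B *ᵥ κ) + ∑ j, flo B N S K κ j • S j

/-! ### One attempt: the query, `x`, and the candidate `u` -/

/-- `(A z)ⱼ = ∑ᵢ zᵢ aᵢⱼ` (an integer; a multiple of `q` when `z ∈ Λ_q(A)`). [cite: MicciancioRegev2007, Lemma 5.8 (step 5)] -/
def Az (q : ℕ) (Kf κf : Fin m → Fin n → ℤ) (z : Fin m → ℤ) (j : Fin n) : ℤ :=
  ∑ i, z i * aEnt B N S q (Kf i) (κf i) j

/-- **`x = ∑ᵢ zᵢ (cᵢ - wᵢ) + ∑ⱼ ((A z)ⱼ / q) sⱼ`** (integer division). [cite: MicciancioRegev2007, Lemma 5.8 (step 5: x = (C - W + SA/q) z)] -/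
def xVec (q : ℕ) (Kf κf : Fin m → Fin n → ℤ) (z : Fin m → ℤ) : Fin n → ℤ :=
  ∑ i, z i • cw B N S (Kf i) (κf i) + ∑ j, (Az B N S q Kf κf z j / q) • S j

/-- **The candidate `u = x - ∑ᵢ zᵢ yᵢ`** (MR07's `s = x - Yz`). [cite: MicciancioRegev2007, Thm. 5.9 (step 4)] -/
def uVec (q : ℕ) (Kf κf : Fin m → Fin n → ℤ) (z : Fin m → ℤ) : Fin n → ℤ :=
  xVec B N S q Kf κf z - ∑ i, z i • yVec B N (Kf i)

/-! ### Membership in `Λ` -/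

variable {B N S}

/-- Integer combinations of vectors of `Λ` are in `Λ`. [folklore] -/
theorem intVec_sum_smul_mem {ι : Type*} (s : Finset ι) {v : ι → Fin n → ℤ}
    (hv : ∀ i ∈ s, intVecToEuclidean n (v i) ∈ dualLat B) (c : ι → ℤ) :
    intVecToEuclidean n (∑ i ∈ s, c i • v i) ∈ dualLat B := by
  rw [map_sum]
  refine Submodule.sum_mem _ fun i hi => ?_
  rw [map_zsmul]
  exact Submodule.smul_mem _ _ (hv i hi)

/-- `yᵢ ∈ Λ`. [cite: MicciancioRegev2007, Lemma 5.7] -/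
theorem yVec_mem (K : Fin n → ℤ) : intVecToEuclidean n (yVec B N K) ∈ dualLat B := by
  rw [yVec, ← Matrix.mulVec_neg]
  exact G_mulVec_mem_dualLat B _

/-- `cᵢ - wᵢ ∈ Λ`. [cite: MicciancioRegev2007, Lemma 5.8 (ii)] -/
theorem cw_mem (hS : ∀ j, intVecToEuclidean n (S j) ∈ dualLat B) (K κ : Fin n → ℤ) :
    intVecToEuclidean n (cw B N S K κ) ∈ dualLat B := by
  rw [cw, map_add]
  refine Submodule.add_mem _ ?_ (intVec_sum_smul_mem _ (fun j _ => hS j) _)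
  rw [← Matrix.mulVec_neg]
  exact G_mulVec_mem_dualLat B _

/-- **`x ∈ Λ`** (an integer combination of lattice vectors). [cite: MicciancioRegev2007, Lemma 5.8 (ii)] -/
theorem xVec_mem (hS : ∀ j, intVecToEuclidean n (S j) ∈ dualLat B) (q : ℕ) (Kf κf : Fin m → Fin n → ℤ)
    (z : Fin m → ℤ) : intVecToEuclidean n (xVec B N S q Kf κf z) ∈ dualLat B := by
  rw [xVec, map_add]
  exact Submodule.add_mem _ (intVec_sum_smul_mem _ (fun i _ => cw_mem hS _ _) _)
    (intVec_sum_smul_mem _ (fun j _ => hS j) _)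

/-- **`u ∈ Λ`.** [cite: MicciancioRegev2007, Thm. 5.9 (proof: s ∈ L(B))] -/
theorem uVec_mem (hS : ∀ j, intVecToEuclidean n (S j) ∈ dualLat B) (q : ℕ) (Kf κf : Fin m → Fin n → ℤ)
    (z : Fin m → ℤ) : intVecToEuclidean n (uVec B N S q Kf κf z) ∈ dualLat B := by
  rw [uVec, map_sub]
  exact Submodule.sub_mem _ (xVec_mem hS q Kf κf z) (intVec_sum_smul_mem _ (fun i _ => yVec_mem (Kf i)) _)

/-! ### The real picture: `∑ⱼ σᵢⱼ sⱼ = rep cᵢ + vᵢ`, the reduced point `wᵢ`, and Lemma 5.8 (ii)–(iii) -/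

/-- The integer identity behind the `S`-coordinates: `∑ⱼ Vᵢⱼ sⱼ = (dT·Dg) · (crepᵢ + N G κᵢ)`. [folklore] -/
theorem sum_Vnum_smul_eq (hB : B.det ≠ 0) (hS : ∀ j, intVecToEuclidean n (S j) ∈ dualLat B)
    (hli : LinearIndependent ℝ fun j => intVecToEuclidean n (S j)) (K κ : Fin n → ℤ) :
    ∑ j, Vnum B N S K κ j • S j = (dT B S * Dg B) • (crep B N K + N • (G B *ᵥ κ)) := by
  -- `∑ⱼ Vⱼ sⱼ = G (TS V)`
  have h1 : ∑ j, Vnum B N S K κ j • S j = G B *ᵥ (TS B S *ᵥ Vnum B N S K κ) := by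
    have hcol : ∀ j, S j = G B *ᵥ tauVec B S j := fun j => (G_mulVec_tauVec hB (hS j)).symm
    conv_lhs => rw [show (fun j => Vnum B N S K κ j • S j) = fun j => Vnum B N S K κ j • (G B *ᵥ tauVec B S j) from
      funext fun j => by rw [← hcol j]]
    rw [show ∑ j, Vnum B N S K κ j • (G B *ᵥ tauVec B S j) = G B *ᵥ ∑ j, Vnum B N S K κ j • tauVec B S j by
      rw [Matrix.mulVec_sum]; exact Finset.sum_congr rfl fun j _ => (Matrix.mulVec_smul _ _ _).symm]
    congr 1
    funext l
    simp only [Matrix.mulVec, dotProduct, TS, Matrix.of_apply, Finset.sum_apply, Pi.smul_apply, smul_eq_mul]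
    exact Finset.sum_congr rfl fun j _ => mul_comm _ _
  -- `TS V = TS GT (B crep + N Dg κ) = dT (B crep + N Dg κ)` and `G B crep = Dg crep`
  have h2 : TS B S *ᵥ Vnum B N S K κ = dT B S • (B *ᵥ crep B N K + ((N : ℤ) * Dg B) • κ) := by
    rw [Vnum, VnumOf, Matrix.mulVec_mulVec, TS_mul_GT hB hS hli, Matrix.smul_mulVec, Matrix.one_mulVec]
  rw [h1, h2, Matrix.mulVec_smul, Matrix.mulVec_add, G_mulVec_B_mulVec hB, Matrix.mulVec_smul]
  funext l
  simp only [Pi.smul_apply, Pi.add_apply]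
  simp only [smul_eq_mul, nsmul_eq_mul]
  ring

variable (B N S) in
/-- The `S`-coordinates `σᵢⱼ = Vᵢⱼ / modM` as real numbers. [folklore] -/
def sigma (K κ : Fin n → ℤ) (j : Fin n) : ℝ := (Vnum B N S K κ j : ℝ) / (modM B N S : ℝ)

/-- **`∑ⱼ σᵢⱼ sⱼ = rep cᵢ + vᵢ`** (`rep cᵢ = crepᵢ/N`, `vᵢ = G κᵢ`). [cite: MicciancioRegev2007, Lemma 5.8 (step 3)] -/
theorem sum_sigma_smul_eq (hB : B.det ≠ 0) [NeZero N] (hS : ∀ j, intVecToEuclidean n (S j) ∈ dualLat B)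
    (hli : LinearIndependent ℝ fun j => intVecToEuclidean n (S j)) (K κ : Fin n → ℤ) :
    ∑ j, sigma B N S K κ j • intVecToEuclidean n (S j) =
      (N : ℝ)⁻¹ • intVecToEuclidean n (crep B N K) + intVecToEuclidean n (G B *ᵥ κ) := by
  have hMpos := modM_pos (N := N) hB hS hli
  have hM : (modM B N S : ℝ) ≠ 0 := by exact_mod_cast hMpos.ne'
  have hN : (N : ℝ) ≠ 0 := NeZero.ne (N : ℝ)
  have hMeq : ((modM B N S : ℤ) : ℝ) = (dT B S : ℝ) * ((N : ℝ) * (Dg B : ℝ)) := by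
    simp [modM]
  have key := congrArg (intVecToEuclidean n) (sum_Vnum_smul_eq (N := N) hB hS hli K κ)
  simp only [map_sum, map_zsmul, map_add, map_nsmul] at key
  have key' : ∑ j, (Vnum B N S K κ j : ℝ) • intVecToEuclidean n (S j) =
      ((dT B S * Dg B : ℤ) : ℝ) • (intVecToEuclidean n (crep B N K) + (N : ℝ) • intVecToEuclidean n (G B *ᵥ κ)) := by
    simpa only [← Int.cast_smul_eq_zsmul ℝ, ← Nat.cast_smul_eq_nsmul ℝ] using key
  calc ∑ j, sigma B N S K κ j • intVecToEuclidean n (S j)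
      = (modM B N S : ℝ)⁻¹ • ∑ j, (Vnum B N S K κ j : ℝ) • intVecToEuclidean n (S j) := by
        rw [Finset.smul_sum]
        refine Finset.sum_congr rfl fun j _ => ?_
        rw [sigma, div_eq_inv_mul, mul_smul]
    _ = (modM B N S : ℝ)⁻¹ • (((dT B S * Dg B : ℤ) : ℝ) •
          (intVecToEuclidean n (crep B N K) + (N : ℝ) • intVecToEuclidean n (G B *ᵥ κ))) := by rw [key']
    _ = (N : ℝ)⁻¹ • (intVecToEuclidean n (crep B N K) + (N : ℝ) • intVecToEuclidean n (G B *ᵥ κ)) := by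
        rw [smul_smul]
        congr 1
        rw [hMeq]; push_cast
        have hdT : (dT B S : ℝ) ≠ 0 := by exact_mod_cast (dT_pos hB hS hli).ne'
        have hDg : (Dg B : ℝ) ≠ 0 := by exact_mod_cast (Dg_pos hB).ne'
        field_simp
    _ = _ := by rw [smul_add, smul_smul, inv_mul_cancel₀ hN, one_smul]

/-- The columns `sⱼ` as a real basis of `ℝⁿ`. [folklore] -/
def sBasis (hli : LinearIndependent ℝ fun j => intVecToEuclidean n (S j)) : Basis (Fin n) ℝ (EuclideanSpace ℝ (Fin n)) :=
  Basis.mk hli (hli.span_eq_top_of_card_eq_finrank' (by simp)).ge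

/-- `sBasis j = sⱼ`. [folklore] -/
@[simp] theorem sBasis_apply (hli : LinearIndependent ℝ fun j => intVecToEuclidean n (S j)) (j : Fin n) :
    sBasis hli j = intVecToEuclidean n (S j) := by
  rw [sBasis, Basis.mk_apply]

variable (B N S) in
/-- **The reduced point `wᵢ = (rep cᵢ + vᵢ) mod P(S) = ∑ⱼ {σᵢⱼ} sⱼ ∈ P(S)`.** [cite: MicciancioRegev2007, Lemma 5.8 (step 2)] -/
def wReal (K κ : Fin n → ℤ) : EuclideanSpace ℝ (Fin n) := ∑ j, Int.fract (sigma B N S K κ j) • intVecToEuclidean n (S j)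

/-- The `S`-coordinates of `wᵢ` are the fractional parts `{σᵢⱼ}`. [folklore] -/
theorem sBasis_repr_wReal (hli : LinearIndependent ℝ fun j => intVecToEuclidean n (S j)) (K κ : Fin n → ℤ) (j : Fin n) :
    (sBasis hli).repr (wReal B N S K κ) j = Int.fract (sigma B N S K κ j) := by
  have h : wReal B N S K κ = ∑ j, Int.fract (sigma B N S K κ j) • sBasis hli j := by
    simp only [wReal, sBasis_apply]
  rw [h, Basis.repr_sum_self]

/-- **`⌊q · {σᵢⱼ}⌋ = aᵢⱼ`**: the query entry of the machine is MR07's `⌊q S⁻¹ wᵢ⌋ⱼ`. [cite: MicciancioRegev2007, Lemma 5.8 (step 3)] -/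
theorem aEnt_eq_floor_fract (hB : B.det ≠ 0) [NeZero N] (hS : ∀ j, intVecToEuclidean n (S j) ∈ dualLat B)
    (hli : LinearIndependent ℝ fun j => intVecToEuclidean n (S j)) {q : ℕ} (hq : 0 < q) (K κ : Fin n → ℤ) (j : Fin n) :
    (aEnt B N S q K κ j : ℤ) = ⌊(q : ℝ) * Int.fract (sigma B N S K κ j)⌋ := by
  have hMpos := modM_pos (N := N) hB hS hli
  set V : ℤ := Vnum B N S K κ j with hV
  set M : ℤ := modM B N S with hMdef
  have hq0 : (0 : ℤ) < q := by exact_mod_cast hq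
  -- `⌊q {V/M}⌋ = ⌊qV/M⌋ - q⌊V/M⌋`
  have h1 : ⌊(q : ℝ) * Int.fract (sigma B N S K κ j)⌋ = (q : ℤ) * V / M - q * (V / M) := by
    rw [Int.fract, sigma, ← hV, ← hMdef, mul_sub]
    have e1 : (q : ℝ) * ((V : ℝ) / (M : ℝ)) = (((q : ℤ) * V : ℤ) : ℝ) / (M : ℝ) := by push_cast; ring
    have e2 : ⌊(V : ℝ) / (M : ℝ)⌋ = V / M := floor_intCast_div_intCast V hMpos
    rw [e1, e2, show (q : ℝ) * ((V / M : ℤ) : ℝ) = (((q : ℤ) * (V / M) : ℤ) : ℝ) by push_cast; ring,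
      Int.floor_sub_intCast, floor_intCast_div_intCast _ hMpos]
  rw [h1, aEnt, ← hV, ← hMdef]
  -- `a % q = a - q ⌊V/M⌋` because `0 ≤ a - q⌊V/M⌋ < q`
  have hlow : (q : ℤ) * (V / M) ≤ (q : ℤ) * V / M := by
    apply Int.le_ediv_of_mul_le hMpos
    calc (q : ℤ) * (V / M) * M = (q : ℤ) * (V / M * M) := by ring
      _ ≤ (q : ℤ) * V := mul_le_mul_of_nonneg_left (Int.ediv_mul_le _ hMpos.ne') hq0.le
  have hup : (q : ℤ) * V / M < (q : ℤ) * (V / M) + q := by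
    apply Int.ediv_lt_of_lt_mul hMpos
    have := Int.lt_ediv_add_one_mul_self V hMpos
    nlinarith
  set a : ℤ := (q : ℤ) * V / M with ha
  set k : ℤ := V / M with hk
  rw [show a % (q : ℤ) = ((a - q * k) + q * k) % q by rw [sub_add_cancel], Int.add_mul_emod_self_left,
    Int.emod_eq_of_lt (by linarith) (by linarith)]

/-- **`cᵢ - wᵢ = cw`**: with `cᵢ = rep cᵢ = crepᵢ/N` and `wᵢ = ∑ⱼ {σᵢⱼ} sⱼ`, the difference is the integer
lattice vector `-G κᵢ + ∑ⱼ ⌊σᵢⱼ⌋ sⱼ`. [cite: MicciancioRegev2007, Lemma 5.8 (proof of (ii))] -/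
theorem coe_crep_sub_wReal (hB : B.det ≠ 0) [NeZero N] (hS : ∀ j, intVecToEuclidean n (S j) ∈ dualLat B)
    (hli : LinearIndependent ℝ fun j => intVecToEuclidean n (S j)) (K κ : Fin n → ℤ) :
    (N : ℝ)⁻¹ • intVecToEuclidean n (crep B N K) - wReal B N S K κ = intVecToEuclidean n (cw B N S K κ) := by
  have hsum := sum_sigma_smul_eq (N := N) hB hS hli K κ
  -- `w = ∑ σⱼ sⱼ - ∑ ⌊σⱼ⌋ sⱼ`
  have hw : wReal B N S K κ = ∑ j, sigma B N S K κ j • intVecToEuclidean n (S j) -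
      ∑ j, (flo B N S K κ j : ℝ) • intVecToEuclidean n (S j) := by
    rw [wReal, ← Finset.sum_sub_distrib]
    refine Finset.sum_congr rfl fun j _ => ?_
    rw [← sub_smul, Int.fract]
    congr 1
    rw [sigma, flo, floor_intCast_div_intCast _ (modM_pos hB hS hli)]
  rw [hw, hsum, cw, map_add, map_neg, map_sum]
  simp only [map_zsmul, ← Int.cast_smul_eq_zsmul ℝ]
  abel

/-- The oracle side, cast: `∑ᵢ zᵢ ⌊q · (S-coordinate of wᵢ)ⱼ⌋ = (A z)ⱼ`. [folklore] -/
theorem sum_mul_floor_repr_eq_Az (hB : B.det ≠ 0) [NeZero N] (hS : ∀ j, intVecToEuclidean n (S j) ∈ dualLat B)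
    (hli : LinearIndependent ℝ fun j => intVecToEuclidean n (S j)) {q : ℕ} (hq : 0 < q)
    (Kf κf : Fin m → Fin n → ℤ) (z : Fin m → ℤ) (j : Fin n) :
    ∑ i, z i * ⌊(q : ℝ) * (sBasis hli).repr (wReal B N S (Kf i) (κf i)) j⌋ = Az B N S q Kf κf z j := by
  refine Finset.sum_congr rfl fun i _ => ?_
  rw [sBasis_repr_wReal, ← aEnt_eq_floor_fract hB hS hli hq]

/-- **MR07 Lemma 5.8 (ii) for the attempt**: when `A z ≡ 0 (mod q)`, the machine's `x` IS the output
`x = ∑ᵢ zᵢ (cᵢ - wᵢ) + q⁻¹ ∑ⱼ (∑ᵢ zᵢ ⌊q S⁻¹wᵢ⌋ⱼ) sⱼ` of the combining procedure `A_F(B, S, C, q)` run with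
`cᵢ = rep cᵢ`, `wᵢ`. [cite: MicciancioRegev2007, Lemma 5.8 (step 5 and (ii))] -/
theorem coe_xVec_eq_combine (hB : B.det ≠ 0) [NeZero N] (hS : ∀ j, intVecToEuclidean n (S j) ∈ dualLat B)
    (hli : LinearIndependent ℝ fun j => intVecToEuclidean n (S j)) {q : ℕ} (hq : 0 < q)
    (Kf κf : Fin m → Fin n → ℤ) (z : Fin m → ℤ) (hdvd : ∀ j, (q : ℤ) ∣ Az B N S q Kf κf z j) :
    intVecToEuclidean n (xVec B N S q Kf κf z) =
      ∑ i, (z i : ℝ) • ((N : ℝ)⁻¹ • intVecToEuclidean n (crep B N (Kf i)) - wReal B N S (Kf i) (κf i)) +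
        (q : ℝ)⁻¹ • ∑ j, ((∑ i, z i * ⌊(q : ℝ) * (sBasis hli).repr (wReal B N S (Kf i) (κf i)) j⌋ : ℤ) : ℝ) •
          (sBasis hli) j := by
  have hq0 : (q : ℝ) ≠ 0 := by exact_mod_cast hq.ne'
  rw [xVec, map_add, map_sum, map_sum]
  congr 1
  · refine Finset.sum_congr rfl fun i _ => ?_
    rw [map_zsmul, ← Int.cast_smul_eq_zsmul ℝ, coe_crep_sub_wReal hB hS hli]
  · rw [Finset.smul_sum]
    refine Finset.sum_congr rfl fun j _ => ?_
    rw [map_zsmul, ← Int.cast_smul_eq_zsmul ℝ, sum_mul_floor_repr_eq_Az hB hS hli hq, sBasis_apply, smul_smul,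
      Int.cast_div (hdvd j) (by exact_mod_cast hq.ne'), div_eq_inv_mul]
    push_cast
    ring_nf

/-- **MR07 Lemma 5.8 (iii) for the attempt**: when `A z ≡ 0 (mod q)` and `‖sⱼ‖ ≤ σ` for all `j`,
`‖x - ∑ᵢ zᵢ cᵢ‖ ≤ n √m ‖z‖ σ / q`. [cite: MicciancioRegev2007, Lemma 5.8 (iii)] -/
theorem norm_xVec_sub_le (hB : B.det ≠ 0) [NeZero N] (hS : ∀ j, intVecToEuclidean n (S j) ∈ dualLat B)
    (hli : LinearIndependent ℝ fun j => intVecToEuclidean n (S j)) {q : ℕ} (hq : 0 < q)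
    (Kf κf : Fin m → Fin n → ℤ) (z : Fin m → ℤ) (hdvd : ∀ j, (q : ℤ) ∣ Az B N S q Kf κf z j)
    {σ : ℝ} (hSσ : ∀ j, ‖intVecToEuclidean n (S j)‖ ≤ σ) :
    ‖intVecToEuclidean n (xVec B N S q Kf κf z) - ∑ i, (z i : ℝ) • ((N : ℝ)⁻¹ • intVecToEuclidean n (crep B N (Kf i)))‖ ≤
      n * Real.sqrt m * ‖intVecToEuclidean m z‖ * σ / q := by
  rw [coe_xVec_eq_combine hB hS hli hq Kf κf z hdvd]
  exact MicciancioRegev2007.norm_combine_sub_le_sqrt (sBasis hli) hq _ _ z (fun j => by rw [sBasis_apply]; exact hSσ j)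

/-- **The candidate in the real picture**: `u = x - ∑ᵢ zᵢ yᵢ` with the lattice vectors `yᵢ` of the
sampling procedure. [cite: MicciancioRegev2007, Thm. 5.9 (proof: s = x - Yz)] -/
theorem coe_uVec_eq (q : ℕ) (Kf κf : Fin m → Fin n → ℤ) (z : Fin m → ℤ) :
    intVecToEuclidean n (uVec B N S q Kf κf z) =
      intVecToEuclidean n (xVec B N S q Kf κf z) - ∑ i, (z i : ℝ) • intVecToEuclidean n (yVec B N (Kf i)) := by
  rw [uVec, map_sub, map_sum]
  congr 1
  exact Finset.sum_congr rfl fun i _ => by rw [map_zsmul, ← Int.cast_smul_eq_zsmul ℝ]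

end DualGrid

end Literature.Algebra.EuclideanLattices

end
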